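import Literature.Probability.RandomPlanarGeometry.ObservableLimitPassage
import HarnessLib

/-!
# `stub_passageUI`: the martingale property passes to the scaling limit (uniformly integrable data)

Stub `stub_passageUI` of the registered skeleton (r4) of the line `room-entropy-wright-fisher`
for the crux `SubseqIdentification` (stmt-CriticalPhenomena-0783, route `SAWRenewalTightness`,
shared with `SAWParafermion` / `SAWLeftRightFKG` / `SAWAsymptoticMorera`): the named lemma
statement `PassageUI`.

This is the tree's abstract passage theorem
`Loewner.integral_cylinder_eq_zero_of_tendstoInDistribution`
(`Literature/Probability/RandomPlanarGeometry/ObservableLimitPassage.lean`) with ONE change of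
hypothesis on the per-scale data `A, B` (values of a discrete martingale at the lattice stopping
steps): instead of being a.e. bounded by a constant `C'`, they are integrable with vanishing
tails on the exceptional event, `∫⁻_{bad} ‖A‖ₑ ∂P_k ≤ η_k`, `∫⁻_{bad} ‖B‖ₑ ∂P_k ≤ η_k`, `η_k → 0`
(in the SAW application `A = F_σ` is a stopped nonnegative Doob martingale of the terminal room
deficit, uniformly integrable but not bounded). Setting: continuous-path processes `V k` on
probability spaces `(Ω' k, P k)` converge in distribution in `C([0, ∞), ℝ)` (Mathlib
`TendstoInDistribution`) to `W` on `(Ω, μ)`; `N_u(w)` is a bounded family of path functionals,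
jointly continuous in `(u, w)`; `ψ` is a continuous cylinder test function, `|ψ| ≤ 1`; for every
`k` the optional-stopping identity `E_k[(B - A) ψ(V^k_S)] = 0` holds and, off `bad`, `A`, `B`
approximate `N_u(V^k)` within `ε_k` at some times `u ∈ [s, s + Δ_k]`, resp. `[t, t + Δ_k]`,
with `ε_k, Δ_k, η_k → 0`. Conclusion: `E_μ[(N_t(W) - N_s(W)) ψ(W_S)] = 0`.

Proof (adapted verbatim from the tree theorem; the constant `C'` was used there only to bound
the contribution of the bad event). The functional `F = (N_t - N_s) ψ(·_S)` is bounded continuous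
on path space, so `E_k[F(V^k)] → E_μ[F(W)]` (portmanteau,
`ProbabilityMeasure.tendsto_iff_forall_integral_rclike_tendsto`). At level `k` with `Δ_k ≤ Δ`,
pointwise `‖F(V^k) - (B - A) ψ(V^k_S)‖ ≤ 2 ε_k + G_Δ(V^k) + 1_bad (2C + ‖A‖ + ‖B‖)` with the
continuous oscillation functional `G_Δ = osc_{[t, t+Δ]} N + osc_{[s, s+Δ]} N`
(`Loewner.continuous_sSup_norm_sub`, `Loewner.sSup_norm_sub_bounds`); integrating,
`|E_k[F(V^k)]| ≤ 2 ε_k + E_k[G_Δ(V^k)] + 2C η_k + 2 η_k` (the tails: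
`∫_{bad} ‖A‖ = (∫⁻_{bad} ‖A‖ₑ).toReal ≤ η_k`, `integral_norm_eq_lintegral_enorm`). Letting
`k → ∞`, `|E_μ[F(W)]| ≤ E_μ[G_Δ(W)]` for every `Δ > 0`, and `E_μ[G_Δ(W)] → 0` as `Δ → 0` by
dominated convergence (pathwise continuity of `u ↦ N_u(W)`). No named fact; axioms `propext`,
`Classical.choice`, `Quot.sound`.

References: D. Chelkak, H. Duminil-Copin, C. Hongler, A. Kemppainen, S. Smirnov, *Convergence of
Ising interfaces to Schramm's SLE curves*, C. R. Math. 352 (2014), §3; H. Duminil-Copin,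
S. Smirnov, *Conformal invariance of lattice models*, Clay Math. Proc. 15 (2012), proof of
Prop. 6.7; P. Billingsley, *Convergence of Probability Measures* (1999), Thm. 2.1.
-/

noncomputable section

open MeasureTheory Filter Topology Set
open scoped NNReal ENNReal Classical BigOperators BoundedContinuousFunction
open Literature.Probability.RandomPlanarGeometry
open UpperHalfPlane (upperHalfPlaneSet)

namespace Summit.CriticalPhenomena.SAWScalingLimit.Theorems.SubseqIdentification.RoomEntropy

/-- The tail bound `∫⁻_{bad} ‖A‖ₑ ≤ η` of an integrable `A` in real form:
`∫_{bad} ‖A‖ ≤ η`. [folklore] -/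
theorem setIntegral_norm_le_of_setLIntegral_enorm_le {α : Type*} {mα : MeasurableSpace α}
    {ν : Measure α} {A : α → ℂ} (hA : Integrable A ν) {bad : Set α} {η : ℝ≥0}
    (h : ∫⁻ ω in bad, ‖A ω‖ₑ ∂ν ≤ η) : ∫ ω in bad, ‖A ω‖ ∂ν ≤ η := by
  rw [integral_norm_eq_lintegral_enorm hA.aestronglyMeasurable.restrict]
  exact ENNReal.toReal_le_coe_of_le_coe h

section Passage

variable {Ω : Type*} {mΩ : MeasurableSpace Ω} {μ : Measure Ω} [IsProbabilityMeasure μ]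
  {Ω' : ℕ → Type*} {mΩ' : ∀ k, MeasurableSpace (Ω' k)} {P : ∀ k, Measure (Ω' k)}
  [∀ k, IsProbabilityMeasure (P k)]
  [MeasurableSpace C(ℝ≥0, ℝ)] [OpensMeasurableSpace C(ℝ≥0, ℝ)]

/-- **The martingale property passes to the scaling limit, uniformly integrable per-scale data**
(the core of the stub, universe-polymorphic with implicit arguments): the statement of
`Loewner.integral_cylinder_eq_zero_of_tendstoInDistribution` with the a.e. bounds
`‖A‖, ‖B‖ ≤ C'` replaced by `Integrable A`, `Integrable B` and the tail bounds
`∫⁻_{bad} ‖A‖ₑ ∂P_k ≤ η_k`, `∫⁻_{bad} ‖B‖ₑ ∂P_k ≤ η_k`. [cite: CDHKSCRAS2014, §3] -/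
theorem integral_cylinder_eq_zero_of_tendstoInDistribution_of_integrable
    {W : ℝ≥0 → Ω → ℝ} (hWc : ∀ ω, Continuous (W · ω))
    {V : ∀ k, ℝ≥0 → Ω' k → ℝ} (hVc : ∀ k ω, Continuous (V k · ω))
    (hlaw : TendstoInDistribution (fun k ω ↦ (⟨fun u ↦ V k u ω, hVc k ω⟩ : C(ℝ≥0, ℝ))) atTop
      (fun ω ↦ (⟨fun u ↦ W u ω, hWc ω⟩ : C(ℝ≥0, ℝ))) P μ)
    {N : ℝ≥0 → C(ℝ≥0, ℝ) → ℂ} (hN : Continuous (Function.uncurry N)) {C : ℝ}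
    (hNC : ∀ u w, ‖N u w‖ ≤ C) (s t : ℝ≥0) {n : ℕ} (S : Fin n → ℝ≥0) {ψ : (Fin n → ℝ) → ℝ}
    (hψc : Continuous ψ) (hψ1 : ∀ v, |ψ v| ≤ 1) {ε Δ η : ℕ → ℝ≥0}
    (hε : Tendsto ε atTop (𝓝 0)) (hΔ : Tendsto Δ atTop (𝓝 0)) (hη : Tendsto η atTop (𝓝 0))
    (happrox : ∀ k, ∃ (A B : Ω' k → ℂ) (bad : Set (Ω' k)), MeasurableSet bad ∧ P k bad ≤ η k ∧
      Integrable A (P k) ∧ Integrable B (P k) ∧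
      ∫⁻ ω in bad, ‖A ω‖ₑ ∂P k ≤ η k ∧ ∫⁻ ω in bad, ‖B ω‖ₑ ∂P k ≤ η k ∧
      ∫ ω, (B ω - A ω) * (ψ (fun i ↦ V k (S i) ω) : ℂ) ∂P k = 0 ∧
      ∀ᵐ ω ∂P k, ω ∉ bad →
        (∃ u ∈ Icc s (s + Δ k), ‖A ω - N u ⟨fun r ↦ V k r ω, hVc k ω⟩‖ ≤ ε k) ∧
        (∃ u ∈ Icc t (t + Δ k), ‖B ω - N u ⟨fun r ↦ V k r ω, hVc k ω⟩‖ ≤ ε k)) :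
    ∫ ω, (N t ⟨fun u ↦ W u ω, hWc ω⟩ - N s ⟨fun u ↦ W u ω, hWc ω⟩) *
      (ψ (fun i ↦ W (S i) ω) : ℂ) ∂μ = 0 := by
  -- adapted from `Loewner.integral_cylinder_eq_zero_of_tendstoInDistribution`
  -- (Literature/Probability/RandomPlanarGeometry/ObservableLimitPassage.lean)
  -- the path maps
  set pW : Ω → C(ℝ≥0, ℝ) := fun ω ↦ ⟨fun u ↦ W u ω, hWc ω⟩ with hpW
  set pV : ∀ k, Ω' k → C(ℝ≥0, ℝ) := fun k ω ↦ ⟨fun u ↦ V k u ω, hVc k ω⟩ with hpV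
  have hpWm : AEMeasurable pW μ := hlaw.aemeasurable_limit
  have hpVm : ∀ k, AEMeasurable (pV k) (P k) := hlaw.forall_aemeasurable
  -- constants
  have hC0 : 0 ≤ C := (norm_nonneg _).trans (hNC 0 0)
  -- the cylinder functional `F = (N_t - N_s) ψ(·_S)`
  have hevalc : Continuous fun w : C(ℝ≥0, ℝ) ↦ (fun i ↦ w (S i) : Fin n → ℝ) :=
    continuous_pi fun i ↦ continuous_eval_const (S i)
  have hNt : ∀ u, Continuous fun w : C(ℝ≥0, ℝ) ↦ N u w := fun u ↦
    hN.comp (continuous_const.prodMk continuous_id)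
  have hψC : Continuous fun w : C(ℝ≥0, ℝ) ↦ (ψ (fun i ↦ w (S i)) : ℂ) :=
    Complex.continuous_ofReal.comp (hψc.comp hevalc)
  set F : C(ℝ≥0, ℝ) → ℂ := fun w ↦ (N t w - N s w) * (ψ (fun i ↦ w (S i)) : ℂ) with hF
  have hFc : Continuous F := ((hNt t).sub (hNt s)).mul hψC
  have hFb : ∀ w, ‖F w‖ ≤ 2 * C := fun w ↦ by
    show ‖(N t w - N s w) * (ψ (fun i ↦ w (S i)) : ℂ)‖ ≤ 2 * C
    rw [norm_mul, Complex.norm_real, Real.norm_eq_abs]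
    have h1 : ‖N t w - N s w‖ ≤ 2 * C :=
      (norm_sub_le _ _).trans (by linarith [hNC t w, hNC s w])
    calc ‖N t w - N s w‖ * |ψ fun i ↦ w (S i)| ≤ 2 * C * 1 :=
          mul_le_mul h1 (hψ1 _) (abs_nonneg _) (by linarith)
      _ = 2 * C := mul_one _
  change ∫ ω, F (pW ω) ∂μ = 0
  -- the oscillation functional `G_Δ`
  set G : ℝ≥0 → C(ℝ≥0, ℝ) → ℝ := fun Δ' w ↦
    sSup ((fun u ↦ ‖N u w - N t w‖) '' Icc t (t + Δ')) +
      sSup ((fun u ↦ ‖N u w - N s w‖) '' Icc s (s + Δ')) with hG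
  have hGc : ∀ Δ', Continuous (G Δ') := fun Δ' ↦
    (Loewner.continuous_sSup_norm_sub hN t Δ').add (Loewner.continuous_sSup_norm_sub hN s Δ')
  have hG0 : ∀ Δ' w, 0 ≤ G Δ' w := fun Δ' w ↦
    add_nonneg (Loewner.sSup_norm_sub_bounds hNC t Δ' w).1
      (Loewner.sSup_norm_sub_bounds hNC s Δ' w).1
  have hGb : ∀ Δ' w, G Δ' w ≤ 4 * C := fun Δ' w ↦ by
    have := add_le_add (Loewner.sSup_norm_sub_bounds hNC t Δ' w).2.1
      (Loewner.sSup_norm_sub_bounds hNC s Δ' w).2.1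
    show _ + _ ≤ 4 * C
    linarith
  have hGnorm : ∀ Δ' w, ‖G Δ' w‖ ≤ 4 * C := fun Δ' w ↦ by
    rw [Real.norm_eq_abs, abs_of_nonneg (hG0 _ _)]; exact hGb _ _
  -- Step 1: for every `Δ' > 0`, `‖E_μ[F(W)]‖ ≤ E_μ[G_Δ'(W)]`
  have hstep : ∀ Δ' : ℝ≥0, 0 < Δ' → ‖∫ ω, F (pW ω) ∂μ‖ ≤ ∫ ω, G Δ' (pW ω) ∂μ := by
    intro Δ' hΔ'
    -- the estimate at level `k`, when `Δ k ≤ Δ'`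
    have hk : ∀ k, Δ k ≤ Δ' → ‖∫ ω, F (pV k ω) ∂P k‖ ≤
        2 * (ε k : ℝ) + ∫ ω, G Δ' (pV k ω) ∂P k + (2 * C + 2) * (η k : ℝ) := by
      intro k hkΔ
      obtain ⟨A, B, bad, hbad, hPbad, hAi, hBi, hAtail, hBtail, hAB, hgood⟩ := happrox k
      have hψm : AEStronglyMeasurable (fun ω ↦ (ψ (fun i ↦ V k (S i) ω) : ℂ)) (P k) :=
        (hψC.measurable.comp_aemeasurable (hpVm k)).aestronglyMeasurable
      have hψb : ∀ ω, ‖(ψ (fun i ↦ V k (S i) ω) : ℂ)‖ ≤ 1 := fun ω ↦ by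
        rw [Complex.norm_real, Real.norm_eq_abs]; exact hψ1 _
      have hFint : Integrable (fun ω ↦ F (pV k ω)) (P k) :=
        (integrable_const (2 * C)).mono'
          (hFc.measurable.comp_aemeasurable (hpVm k)).aestronglyMeasurable
          (ae_of_all _ fun ω ↦ hFb _)
      have hBAint : Integrable (fun ω ↦ (B ω - A ω) * (ψ (fun i ↦ V k (S i) ω) : ℂ)) (P k) :=
        (hBi.sub hAi).mul_bdd hψm (ae_of_all _ hψb)
      have hGint : Integrable (fun ω ↦ G Δ' (pV k ω)) (P k) :=
        (integrable_const (4 * C)).mono'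
          ((hGc Δ').measurable.comp_aemeasurable (hpVm k)).aestronglyMeasurable
          (ae_of_all _ fun ω ↦ hGnorm _ _)
      have hIint : Integrable (bad.indicator fun _ ↦ (1 : ℝ)) (P k) :=
        (integrable_const (1 : ℝ)).indicator hbad
      have hTint : Integrable (bad.indicator fun ω ↦ ‖A ω‖ + ‖B ω‖) (P k) :=
        (hAi.norm.add hBi.norm).indicator hbad
      -- the pointwise bound
      set bound : Ω' k → ℝ := fun ω ↦
        2 * (ε k : ℝ) + G Δ' (pV k ω) + 2 * C * bad.indicator (fun _ ↦ (1 : ℝ)) ω +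
          bad.indicator (fun ω ↦ ‖A ω‖ + ‖B ω‖) ω
        with hbound
      have hbound_int : Integrable bound (P k) :=
        (((integrable_const _).add hGint).add (hIint.const_mul _)).add hTint
      have hpt : ∀ᵐ ω ∂P k,
          ‖F (pV k ω) - (B ω - A ω) * (ψ (fun i ↦ V k (S i) ω) : ℂ)‖ ≤ bound ω := by
        filter_upwards [hgood] with ω hω
        have hψle : |ψ (fun i ↦ V k (S i) ω)| ≤ 1 := hψ1 _
        have hFp : F (pV k ω) =
            (N t (pV k ω) - N s (pV k ω)) * (ψ (fun i ↦ V k (S i) ω) : ℂ) := rfl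
        rw [hFp, ← sub_mul, norm_mul, Complex.norm_real, Real.norm_eq_abs]
        have hdiff : N t (pV k ω) - N s (pV k ω) - (B ω - A ω) =
            (N t (pV k ω) - B ω) - (N s (pV k ω) - A ω) := by ring
        rw [hdiff]
        have hind0 : 0 ≤ bad.indicator (fun _ ↦ (1 : ℝ)) ω :=
          Set.indicator_nonneg (fun _ _ ↦ zero_le_one) _
        have hindT0 : 0 ≤ bad.indicator (fun ω ↦ ‖A ω‖ + ‖B ω‖) ω :=
          Set.indicator_nonneg (fun _ _ ↦ add_nonneg (norm_nonneg _) (norm_nonneg _)) _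
        have hGω := hG0 Δ' (pV k ω)
        by_cases hωbad : ω ∈ bad
        · have h1 : ‖N t (pV k ω) - B ω - (N s (pV k ω) - A ω)‖ ≤ 2 * C + (‖A ω‖ + ‖B ω‖) :=
            calc ‖N t (pV k ω) - B ω - (N s (pV k ω) - A ω)‖
                ≤ ‖N t (pV k ω) - B ω‖ + ‖N s (pV k ω) - A ω‖ := norm_sub_le _ _
              _ ≤ (‖N t (pV k ω)‖ + ‖B ω‖) + (‖N s (pV k ω)‖ + ‖A ω‖) :=
                  add_le_add (norm_sub_le _ _) (norm_sub_le _ _)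
              _ ≤ (C + ‖B ω‖) + (C + ‖A ω‖) :=
                  add_le_add (add_le_add (hNC _ _) le_rfl) (add_le_add (hNC _ _) le_rfl)
              _ = 2 * C + (‖A ω‖ + ‖B ω‖) := by ring
          have hind : bad.indicator (fun _ ↦ (1 : ℝ)) ω = 1 := Set.indicator_of_mem hωbad _
          have hindT : bad.indicator (fun ω ↦ ‖A ω‖ + ‖B ω‖) ω = ‖A ω‖ + ‖B ω‖ :=
            Set.indicator_of_mem hωbad _
          calc ‖N t (pV k ω) - B ω - (N s (pV k ω) - A ω)‖ * |ψ fun i ↦ V k (S i) ω|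
              ≤ (2 * C + (‖A ω‖ + ‖B ω‖)) * 1 :=
                mul_le_mul h1 hψle (abs_nonneg _) (by positivity)
            _ ≤ bound ω := by
                show _ ≤ 2 * (ε k : ℝ) + G Δ' (pV k ω) +
                  2 * C * bad.indicator (fun _ ↦ (1 : ℝ)) ω +
                    bad.indicator (fun ω ↦ ‖A ω‖ + ‖B ω‖) ω
                rw [hind, hindT]
                linarith [(ε k).coe_nonneg]
        · obtain ⟨⟨uA, huA, hA'⟩, ⟨uB, huB, hB'⟩⟩ := hω hωbad
          have huA' : uA ∈ Icc s (s + Δ') := ⟨huA.1, huA.2.trans (add_le_add le_rfl hkΔ)⟩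
          have huB' : uB ∈ Icc t (t + Δ') := ⟨huB.1, huB.2.trans (add_le_add le_rfl hkΔ)⟩
          have hoscB := (Loewner.sSup_norm_sub_bounds hNC t Δ' (pV k ω)).2.2 uB huB'
          have hoscA := (Loewner.sSup_norm_sub_bounds hNC s Δ' (pV k ω)).2.2 uA huA'
          have htri : ∀ (x b nu : ℂ), ‖x - b‖ ≤ ‖nu - x‖ + ‖b - nu‖ := fun x b nu ↦ by
            calc ‖x - b‖ ≤ ‖x - nu‖ + ‖nu - b‖ := norm_sub_le_norm_sub_add_norm_sub _ _ _
              _ = ‖nu - x‖ + ‖b - nu‖ := by rw [norm_sub_rev x nu, norm_sub_rev nu b]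
          have h1 : ‖N t (pV k ω) - B ω - (N s (pV k ω) - A ω)‖ ≤
              2 * (ε k : ℝ) + G Δ' (pV k ω) :=
            calc ‖N t (pV k ω) - B ω - (N s (pV k ω) - A ω)‖
                ≤ ‖N t (pV k ω) - B ω‖ + ‖N s (pV k ω) - A ω‖ := norm_sub_le _ _
              _ ≤ (‖N uB (pV k ω) - N t (pV k ω)‖ + ‖B ω - N uB (pV k ω)‖) +
                    (‖N uA (pV k ω) - N s (pV k ω)‖ + ‖A ω - N uA (pV k ω)‖) :=
                  add_le_add (htri _ _ _) (htri _ _ _)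
              _ ≤ (sSup ((fun u ↦ ‖N u (pV k ω) - N t (pV k ω)‖) '' Icc t (t + Δ')) + ε k) +
                    (sSup ((fun u ↦ ‖N u (pV k ω) - N s (pV k ω)‖) '' Icc s (s + Δ')) + ε k) :=
                  add_le_add (add_le_add hoscB hB') (add_le_add hoscA hA')
              _ = 2 * (ε k : ℝ) + G Δ' (pV k ω) := by
                  show _ = 2 * (ε k : ℝ) + (_ + _)
                  ring
          calc ‖N t (pV k ω) - B ω - (N s (pV k ω) - A ω)‖ * |ψ fun i ↦ V k (S i) ω|
              ≤ (2 * (ε k : ℝ) + G Δ' (pV k ω)) * 1 :=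
                mul_le_mul h1 hψle (abs_nonneg _) (by positivity)
            _ ≤ bound ω := by
                show _ ≤ 2 * (ε k : ℝ) + G Δ' (pV k ω) +
                  2 * C * bad.indicator (fun _ ↦ (1 : ℝ)) ω +
                    bad.indicator (fun ω ↦ ‖A ω‖ + ‖B ω‖) ω
                rw [mul_one]
                nlinarith
      -- integrate
      have hPreal : (P k).real bad ≤ η k := by
        rw [measureReal_def]
        exact ENNReal.toReal_le_coe_of_le_coe hPbad
      have hTreal : ∫ ω, bad.indicator (fun ω ↦ ‖A ω‖ + ‖B ω‖) ω ∂P k ≤ 2 * (η k : ℝ) := by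
        rw [integral_indicator hbad, integral_add hAi.norm.integrableOn hBi.norm.integrableOn]
        have hA2 := setIntegral_norm_le_of_setLIntegral_enorm_le hAi hAtail
        have hB2 := setIntegral_norm_le_of_setLIntegral_enorm_le hBi hBtail
        linarith
      calc ‖∫ ω, F (pV k ω) ∂P k‖
          = ‖∫ ω, (F (pV k ω) - (B ω - A ω) * (ψ (fun i ↦ V k (S i) ω) : ℂ)) ∂P k‖ := by
            rw [integral_sub hFint hBAint, hAB, sub_zero]
        _ ≤ ∫ ω, ‖F (pV k ω) - (B ω - A ω) * (ψ (fun i ↦ V k (S i) ω) : ℂ)‖ ∂P k :=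
            norm_integral_le_integral_norm _
        _ ≤ ∫ ω, bound ω ∂P k := integral_mono_ae (hFint.sub hBAint).norm hbound_int hpt
        _ = 2 * (ε k : ℝ) + ∫ ω, G Δ' (pV k ω) ∂P k + 2 * C * (P k).real bad +
              ∫ ω, bad.indicator (fun ω ↦ ‖A ω‖ + ‖B ω‖) ω ∂P k := by
            have hI1 : Integrable (fun ω ↦ 2 * (ε k : ℝ) + G Δ' (pV k ω)) (P k) :=
              (integrable_const _).add hGint
            have hI2 : Integrable
                (fun ω ↦ 2 * C * bad.indicator (fun _ ↦ (1 : ℝ)) ω) (P k) :=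
              hIint.const_mul _
            have hI12 : Integrable (fun ω ↦ 2 * (ε k : ℝ) + G Δ' (pV k ω) +
                2 * C * bad.indicator (fun _ ↦ (1 : ℝ)) ω) (P k) := hI1.add hI2
            show ∫ ω, (2 * (ε k : ℝ) + G Δ' (pV k ω) +
              2 * C * bad.indicator (fun _ ↦ (1 : ℝ)) ω +
                bad.indicator (fun ω ↦ ‖A ω‖ + ‖B ω‖) ω) ∂P k = _
            rw [integral_add hI12 hTint, integral_add hI1 hI2,
              integral_add (integrable_const _) hGint,
              integral_const_mul (2 * C), integral_indicator_const _ hbad, integral_const]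
            simp
        _ ≤ 2 * (ε k : ℝ) + ∫ ω, G Δ' (pV k ω) ∂P k + 2 * C * (η k : ℝ) + 2 * (η k : ℝ) := by
            gcongr
        _ = 2 * (ε k : ℝ) + ∫ ω, G Δ' (pV k ω) ∂P k + (2 * C + 2) * (η k : ℝ) := by ring
    -- the limits as `k → ∞`
    have hlimF : Tendsto (fun k ↦ ∫ ω, F (pV k ω) ∂P k) atTop (𝓝 (∫ ω, F (pW ω) ∂μ)) := by
      set fF : C(ℝ≥0, ℝ) →ᵇ ℂ := BoundedContinuousFunction.ofNormedAddCommGroup F hFc (2 * C) hFb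
        with hfF
      have key :=
        (ProbabilityMeasure.tendsto_iff_forall_integral_rclike_tendsto ℂ).1 hlaw.tendsto fF
      simp only [ProbabilityMeasure.coe_mk] at key
      rw [integral_map hpWm fF.continuous.aestronglyMeasurable] at key
      refine key.congr fun k ↦ ?_
      rw [integral_map (hpVm k) fF.continuous.aestronglyMeasurable]
      rfl
    have hlimG : Tendsto (fun k ↦ ∫ ω, G Δ' (pV k ω) ∂P k) atTop (𝓝 (∫ ω, G Δ' (pW ω) ∂μ)) := by
      set fG : C(ℝ≥0, ℝ) →ᵇ ℝ :=
        BoundedContinuousFunction.ofNormedAddCommGroup (G Δ') (hGc Δ') (4 * C) (hGnorm Δ') with hfG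
      have key := ProbabilityMeasure.tendsto_iff_forall_integral_tendsto.1 hlaw.tendsto fG
      simp only [ProbabilityMeasure.coe_mk] at key
      rw [integral_map hpWm fG.continuous.aestronglyMeasurable] at key
      refine key.congr fun k ↦ ?_
      rw [integral_map (hpVm k) fG.continuous.aestronglyMeasurable]
      rfl
    have hε' : Tendsto (fun k ↦ (ε k : ℝ)) atTop (𝓝 0) := NNReal.tendsto_coe.2 hε
    have hη' : Tendsto (fun k ↦ (η k : ℝ)) atTop (𝓝 0) := NNReal.tendsto_coe.2 hη
    have hlimRHS : Tendsto
        (fun k ↦ 2 * (ε k : ℝ) + ∫ ω, G Δ' (pV k ω) ∂P k + (2 * C + 2) * (η k : ℝ))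
        atTop (𝓝 (2 * 0 + ∫ ω, G Δ' (pW ω) ∂μ + (2 * C + 2) * 0)) :=
      ((hε'.const_mul 2).add hlimG).add (hη'.const_mul _)
    rw [mul_zero, mul_zero, zero_add, add_zero] at hlimRHS
    have hev : ∀ᶠ k in atTop, Δ k ≤ Δ' := hΔ.eventually (Iic_mem_nhds hΔ')
    exact le_of_tendsto_of_tendsto hlimF.norm hlimRHS (hev.mono fun k hkΔ ↦ hk k hkΔ)
  -- Step 2: `E_μ[G_{1/(m+1)}(W)] → 0` by dominated convergence
  have hpt0 : ∀ w : C(ℝ≥0, ℝ), Tendsto (fun m : ℕ ↦ G ((m : ℝ≥0) + 1)⁻¹ w) atTop (𝓝 0) := by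
    intro w
    rw [Metric.tendsto_atTop]
    intro e he
    have hcu : ∀ u₀ : ℝ≥0, ∃ θ > 0, ∀ u : ℝ≥0, dist u u₀ < θ → ‖N u w - N u₀ w‖ < e / 4 := by
      intro u₀
      have hc : Continuous fun u : ℝ≥0 ↦ N u w := hN.comp (continuous_id.prodMk continuous_const)
      obtain ⟨θ, hθ, h⟩ := Metric.continuousAt_iff.1 (hc.continuousAt (x := u₀)) (e / 4)
        (by positivity)
      exact ⟨θ, hθ, fun u hu ↦ by have := h hu; rwa [dist_eq_norm] at this⟩
    obtain ⟨θt, hθt, ht⟩ := hcu t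
    obtain ⟨θs, hθs, hs⟩ := hcu s
    obtain ⟨m₀, hm₀⟩ := exists_nat_one_div_lt (lt_min hθt hθs)
    refine ⟨m₀, fun m hm ↦ ?_⟩
    have hθ' : ((((m : ℝ≥0) + 1)⁻¹ : ℝ≥0) : ℝ) < min θt θs := by
      have h1 : ((((m : ℝ≥0) + 1)⁻¹ : ℝ≥0) : ℝ) = 1 / ((m : ℝ) + 1) := by
        simp only [NNReal.coe_inv, NNReal.coe_add, NNReal.coe_natCast, NNReal.coe_one, one_div]
      rw [h1]
      calc 1 / ((m : ℝ) + 1) ≤ 1 / ((m₀ : ℝ) + 1) :=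
            one_div_le_one_div_of_le (by positivity)
              (by have : (m₀ : ℝ) ≤ m := by exact_mod_cast hm
                  linarith)
        _ < min θt θs := hm₀
    have hwithin : ∀ (u₀ : ℝ≥0) (θ : ℝ), min θt θs ≤ θ → ∀ u ∈ Icc u₀ (u₀ + ((m : ℝ≥0) + 1)⁻¹),
        dist u u₀ < θ := by
      intro u₀ θ hθ u hu
      rw [NNReal.dist_eq]
      have h1 : (u₀ : ℝ) ≤ u := NNReal.coe_le_coe.2 hu.1
      have h2 : (u : ℝ) ≤ u₀ + ((((m : ℝ≥0) + 1)⁻¹ : ℝ≥0) : ℝ) := by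
        have := NNReal.coe_le_coe.2 hu.2
        rwa [NNReal.coe_add] at this
      rw [abs_of_nonneg (by linarith)]
      linarith
    have hbt : sSup ((fun u ↦ ‖N u w - N t w‖) '' Icc t (t + ((m : ℝ≥0) + 1)⁻¹)) ≤ e / 4 := by
      refine csSup_le ⟨_, t, ⟨le_rfl, le_self_add⟩, rfl⟩ ?_
      rintro _ ⟨u, hu, rfl⟩
      exact (ht u (hwithin t θt (min_le_left _ _) u hu)).le
    have hbs : sSup ((fun u ↦ ‖N u w - N s w‖) '' Icc s (s + ((m : ℝ≥0) + 1)⁻¹)) ≤ e / 4 := by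
      refine csSup_le ⟨_, s, ⟨le_rfl, le_self_add⟩, rfl⟩ ?_
      rintro _ ⟨u, hu, rfl⟩
      exact (hs u (hwithin s θs (min_le_right _ _) u hu)).le
    rw [Real.dist_eq, sub_zero, abs_of_nonneg (hG0 _ _)]
    calc G ((m : ℝ≥0) + 1)⁻¹ w = _ + _ := rfl
      _ ≤ e / 4 + e / 4 := add_le_add hbt hbs
      _ < e := by linarith
  have hG_tend : Tendsto (fun m : ℕ ↦ ∫ ω, G ((m : ℝ≥0) + 1)⁻¹ (pW ω) ∂μ) atTop (𝓝 0) := by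
    have := tendsto_integral_of_dominated_convergence (μ := μ)
      (F := fun (m : ℕ) ω ↦ G ((m : ℝ≥0) + 1)⁻¹ (pW ω)) (f := fun _ ↦ (0 : ℝ)) (fun _ ↦ 4 * C)
      (fun m ↦ ((hGc _).measurable.comp_aemeasurable hpWm).aestronglyMeasurable)
      (integrable_const _) (fun m ↦ ae_of_all _ fun ω ↦ hGnorm _ _)
      (ae_of_all _ fun ω ↦ hpt0 (pW ω))
    simpa using this
  -- Step 3: conclusion
  have hle : ∀ m : ℕ, ‖∫ ω, F (pW ω) ∂μ‖ ≤ ∫ ω, G ((m : ℝ≥0) + 1)⁻¹ (pW ω) ∂μ := fun m ↦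
    hstep _ (inv_pos.2 (by positivity))
  exact norm_le_zero_iff.1 (ge_of_tendsto' hG_tend hle)

end Passage

/-- **`PassageUI`** (registered stub `stub_passageUI` of the line `room-entropy-wright-fisher`,
crux `SubseqIdentification`, stmt-CriticalPhenomena-0783): the abstract passage of the martingale
property to the scaling limit of the driving processes, with uniformly integrable (integrable,
with vanishing tails on the exceptional events) instead of a.e. bounded per-scale data —
`integral_cylinder_eq_zero_of_tendstoInDistribution_of_integrable` with all arguments explicit.
[cite: CDHKSCRAS2014, §3] -/
theorem stub_passageUI :
    ∀ (Ω : Type) (mΩ : MeasurableSpace Ω) (μ : Measure Ω) [IsProbabilityMeasure μ]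
      (Ω' : ℕ → Type) (mΩ' : ∀ k, MeasurableSpace (Ω' k)) (P : ∀ k, Measure (Ω' k))
      [∀ k, IsProbabilityMeasure (P k)] [MeasurableSpace C(ℝ≥0, ℝ)] [OpensMeasurableSpace C(ℝ≥0, ℝ)]
      (W : ℝ≥0 → Ω → ℝ) (hWc : ∀ ω, Continuous (W · ω))
      (V : ∀ k, ℝ≥0 → Ω' k → ℝ) (hVc : ∀ k ω, Continuous (V k · ω)),
      TendstoInDistribution (fun k ω => (⟨fun u => V k u ω, hVc k ω⟩ : C(ℝ≥0, ℝ))) atTop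
        (fun ω => (⟨fun u => W u ω, hWc ω⟩ : C(ℝ≥0, ℝ))) P μ →
      ∀ (N : ℝ≥0 → C(ℝ≥0, ℝ) → ℂ), Continuous (Function.uncurry N) →
      ∀ (C : ℝ), (∀ u w, ‖N u w‖ ≤ C) →
      ∀ (s t : ℝ≥0) (n : ℕ) (S : Fin n → ℝ≥0) (ψ : (Fin n → ℝ) → ℝ), Continuous ψ → (∀ v, |ψ v| ≤ 1) →
      ∀ (ε Δ η : ℕ → ℝ≥0), Tendsto ε atTop (𝓝 0) → Tendsto Δ atTop (𝓝 0) → Tendsto η atTop (𝓝 0) →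
      (∀ k, ∃ (A B : Ω' k → ℂ) (bad : Set (Ω' k)), MeasurableSet bad ∧ P k bad ≤ η k ∧
        Integrable A (P k) ∧ Integrable B (P k) ∧
        ∫⁻ ω in bad, ‖A ω‖ₑ ∂P k ≤ η k ∧ ∫⁻ ω in bad, ‖B ω‖ₑ ∂P k ≤ η k ∧
        ∫ ω, (B ω - A ω) * (ψ (fun i => V k (S i) ω) : ℂ) ∂P k = 0 ∧
        ∀ᵐ ω ∂P k, ω ∉ bad →
          (∃ u ∈ Icc s (s + Δ k), ‖A ω - N u ⟨fun r => V k r ω, hVc k ω⟩‖ ≤ ε k) ∧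
          (∃ u ∈ Icc t (t + Δ k), ‖B ω - N u ⟨fun r => V k r ω, hVc k ω⟩‖ ≤ ε k)) →
      ∫ ω, (N t ⟨fun u => W u ω, hWc ω⟩ - N s ⟨fun u => W u ω, hWc ω⟩) *
        (ψ (fun i => W (S i) ω) : ℂ) ∂μ = 0 := by
  intro Ω mΩ μ _ Ω' mΩ' P _ _ _ W hWc V hVc hlaw N hN C hNC s t n S ψ hψc hψ1 ε Δ η hε hΔ hη happrox
  exact integral_cylinder_eq_zero_of_tendstoInDistribution_of_integrable hWc hVc hlaw hN hNC s t S
    hψc hψ1 hε hΔ hη happrox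

end Summit.CriticalPhenomena.SAWScalingLimit.Theorems.SubseqIdentification.RoomEntropy

end
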